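import Mathlib.Analysis.Convex.Topology
import Literature.Analysis.PDE.HopfMinimumPrinciple
import Literature.Analysis.FluidPDE.HouSelfSimilarCirculationSign
import HarnessLib

/-!
# Strict sign of the circulation exponent at `n = 3`: `c_Γ = c_u + 2c_l > 0`
# (E. Hopf's strong maximum principle for the steady rescaled circulation equation)

Topic `Literature/Analysis/FluidPDE`. Theorems only (no definitions, no named facts), about the
tree's predicate `HouSelfSimilarProfile n ν₀ cl cu U Ω Ψ` (`HouTwoScaleRescaling.lean`: Hou's steady
one-scale self-similar profile system, arXiv:2405.10916 §3). Companion of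
`HouSelfSimilarCirculationSign.lean`, which proves `0 ≤ c_u + 2c_l` (`n ≥ 3`) and `> 0` (`n > 3`,
`ν₀ > 0`) for profiles with DECAYING circulation `Γ̃ = ξ² ũ₁ → 0` by the weak maximum principle and
leaves the strict inequality at the physical dimension `n = 3` open.

## What is proved

* `HouSelfSimilarProfile.circulationExponent_pos_of_tendsto_zero_of_eq_three` — **`n = 3`, `ν₀ > 0`:
  `0 < c_u + 2c_l`** for every profile whose circulation tends to `0` at infinity and whose swirl is
  not identically zero off the axis. If `c_Γ = 0`, the circulation equation at `n = 3`
  (`circulation_eq`; the zeroth-order coefficient `(6 − 2n)/ξ²` vanishes) reads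
  `ν₀(Γ̃_ξξ + Γ̃_ηη) − (ν₀/ξ + c_lξ + ũ^ξ)Γ̃_ξ − (c_lη + ũ^η)Γ̃_η = 0` on the open half-plane `{ξ > 0}`;
  `Γ̃` (or `−Γ̃`) attains a positive maximum there (it vanishes on the axis, is even in `ξ`, decays),
  so E. Hopf's minimum principle (tree: `Literature.Analysis.PDE.hopf_minimumPrinciple`, López-Gómez
  2012 Thm. 1.2; applied to `−Γ̃ ∘ T`, `T x = (x₀, x₁)`, on `{x₀ > 0} ⊆ ℝ²` with `a = I`,
  `b = (1/ξ + (c_lξ + ũ^ξ)/ν₀, (c_lη + ũ^η)/ν₀)`, `c = 0`) makes `Γ̃ ≡ max Γ̃ > 0` on the half-plane —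
  contradicting the decay.
* `…_of_three_le` — the unified strict form for all `n ≥ 3`, `ν₀ > 0`; contrapositive
  `not_tendsto_circulation_zero_of_circulationExponent_nonpos_of_three_le`: a nontrivial profile with
  `c_u + 2c_l ≤ 0` — in particular one AT the Navier–Stokes gauge `ĉ_l = ½` — cannot have decaying
  circulation.
* `half_lt_collapseExponent`, `HouScalingExponents.half_lt_hat_clz` — dictionary: on the blow-up side
  `κ = −c_u > 0`, `0 < c_u + 2c_l` is `½ < ĉ_l`: the normalized length exponent of a
  decaying-circulation MODEL profile is STRICTLY above the parabolic value `½` (at which the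
  solution-dependent viscosity of `HouScalingExponents.physicalViscosity_eq_rpow` is constant).

Use: kernel form of the `n = 3` clause of the pen lemma "PS5-3-STRUCT / LEMMA′" of the `ns-blowup`
profile cell (zone Z5): along any family of such profiles `ĉ_l = ½` is NOT attained with decaying
circulation (only approached, e.g. as `ν₀ → 0`, or reached with non-decaying circulation).

WHAT THIS IS NOT: nothing here asserts existence of a nontrivial profile or anything about
Navier–Stokes blow-up — a-priori sign constraints on exponents of HYPOTHETICAL smooth solutions of
a MODEL profile system.

Search: tree `hopf_minimumPrinciple` (use pattern of `SverakLandauRadialVorticity.lean`: `a = I`,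
`c = 0`), `HouSelfSimilarProfile.circulation_eq/.neg/.circulationExponent_{nonneg,pos}_of_tendsto_zero`,
`derivR/derivZ`, `GeneralizedAxisymNS.radialVel/axialVel`; Mathlib `EuclideanSpace.proj`,
`HasFDerivAt.comp`, `fderiv_clm_apply`, `convex_halfSpace_gt`, `Convex.isPreconnected`,
`IsCompact.exists_bound_of_continuousOn`, `mem_cocompact`, `isBounded_iff_forall_norm_le`.
-/

noncomputable section

open Set Filter Metric
open scoped Topology ContDiff

namespace Literature.Analysis.FluidPDE

/-! ### Transfer between `EuclideanSpace ℝ (Fin 2)` and the meridian plane `ℝ × ℝ` (private) -/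

variable {T : EuclideanSpace ℝ (Fin 2) →L[ℝ] ℝ × ℝ}

/-- Chain rule through a continuous linear map `T`: `D(G ∘ T)(x) v = DG(Tx)(Tv)`. [folklore] -/
private theorem fderiv_comp_clm {G : ℝ × ℝ → ℝ} (hG : Differentiable ℝ G)
    (x v : EuclideanSpace ℝ (Fin 2)) :
    fderiv ℝ (fun y => G (T y)) x v = fderiv ℝ G (T x) (T v) := by
  have h : HasFDerivAt (fun y => G (T y)) ((fderiv ℝ G (T x)).comp T) x :=
    (hG (T x)).hasFDerivAt.comp x T.hasFDerivAt
  rw [h.fderiv]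
  rfl

/-- Second-order chain rule through `T`: `D²(G ∘ T)(x)(v)(w) = D(p ↦ DG(p)(Tw))(Tx)(Tv)` for smooth
`G`. [folklore] -/
private theorem fderiv_fderiv_comp_clm {G : ℝ × ℝ → ℝ} (hG : ContDiff ℝ ∞ G)
    (x v w : EuclideanSpace ℝ (Fin 2)) :
    fderiv ℝ (fderiv ℝ (fun y => G (T y))) x v w =
      fderiv ℝ (fun p => fderiv ℝ G p (T w)) (T x) (T v) := by
  have hGd : Differentiable ℝ G := hG.differentiable (by simp)
  have hG1 : ContDiff ℝ ∞ (fun p => fderiv ℝ G p (T w)) :=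
    (hG.fderiv_right (m := ∞) (by exact_mod_cast le_top)).clm_apply contDiff_const
  have hu : ContDiff ℝ ∞ (fun y => G (T y)) := hG.comp T.contDiff
  have hdu : DifferentiableAt ℝ (fderiv ℝ (fun y => G (T y))) x :=
    ((hu.fderiv_right (m := ∞) (by exact_mod_cast le_top)).differentiable (by simp)) x
  have e1 : fderiv ℝ (fderiv ℝ (fun y => G (T y))) x v w =
      fderiv ℝ (fun y => fderiv ℝ (fun y => G (T y)) y w) x v := by
    rw [fderiv_clm_apply hdu (differentiableAt_const _)]
    simp [fderiv_fun_const]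
  have e2 : (fun y => fderiv ℝ (fun y => G (T y)) y w) =
      fun y => (fun p => fderiv ℝ G p (T w)) (T y) := by
    funext y
    exact fderiv_comp_clm hGd y w
  rw [e1, e2, fderiv_comp_clm (hG1.differentiable (by simp))]

/-- `∂₀∂₀(G ∘ T) = (∂ᵣ∂ᵣG) ∘ T` when `T e₀ = (1, 0)`. [folklore] -/
private theorem fderiv_fderiv_comp_clm_zero_zero {G : ℝ × ℝ → ℝ} (hG : ContDiff ℝ ∞ G)
    (hT0 : T (EuclideanSpace.single 0 1) = ((1 : ℝ), (0 : ℝ))) (x : EuclideanSpace ℝ (Fin 2)) :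
    fderiv ℝ (fderiv ℝ (fun y => G (T y))) x (EuclideanSpace.single 0 1)
        (EuclideanSpace.single 0 1) = derivR (derivR G) (T x) := by
  rw [fderiv_fderiv_comp_clm hG, hT0]
  have e : (fun p => fderiv ℝ G p ((1 : ℝ), (0 : ℝ))) = derivR G := by
    funext p; rw [derivR_apply]
  rw [e, derivR_apply]

/-- `∂₁∂₁(G ∘ T) = (∂_z∂_zG) ∘ T` when `T e₁ = (0, 1)`. [folklore] -/
private theorem fderiv_fderiv_comp_clm_one_one {G : ℝ × ℝ → ℝ} (hG : ContDiff ℝ ∞ G)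
    (hT1 : T (EuclideanSpace.single 1 1) = ((0 : ℝ), (1 : ℝ))) (x : EuclideanSpace ℝ (Fin 2)) :
    fderiv ℝ (fderiv ℝ (fun y => G (T y))) x (EuclideanSpace.single 1 1)
        (EuclideanSpace.single 1 1) = derivZ (derivZ G) (T x) := by
  rw [fderiv_fderiv_comp_clm hG, hT1]
  have e : (fun p => fderiv ℝ G p ((0 : ℝ), (1 : ℝ))) = derivZ G := by
    funext p; rw [derivZ_apply]
  rw [e, derivZ_apply]

/-! ### The open right half-plane in `EuclideanSpace ℝ (Fin 2)` (private) -/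

/-- `{x₀ > 0}` is open. [folklore] -/
private theorem isOpen_halfPlane : IsOpen {x : EuclideanSpace ℝ (Fin 2) | 0 < x 0} :=
  isOpen_lt continuous_const (EuclideanSpace.proj (0 : Fin 2)).continuous

/-- `{x₀ > 0}` is preconnected (convex). [folklore] -/
private theorem isPreconnected_halfPlane :
    IsPreconnected {x : EuclideanSpace ℝ (Fin 2) | 0 < x 0} :=
  (convex_halfSpace_gt (EuclideanSpace.proj (0 : Fin 2)).isLinear 0).isPreconnected

/-! ### Two facts about decaying circulations (private) -/

/-- If `p ↦ ξ²U(p)` (with `U` continuous and even in `ξ`) decays at infinity and is positive somewhere,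
it attains a positive GLOBAL maximum at a point with `ξ > 0`. [folklore] -/
private theorem exists_isMaxOn_circulation {U : ℝ × ℝ → ℝ} (hU : Continuous U)
    (heven : ∀ ξ η : ℝ, U (-ξ, η) = U (ξ, η))
    (hdecay : Tendsto (fun p : ℝ × ℝ => p.1 ^ 2 * U p) (cocompact (ℝ × ℝ)) (𝓝 0))
    {q₀ : ℝ × ℝ} (hpos : 0 < q₀.1 ^ 2 * U q₀) :
    ∃ q : ℝ × ℝ, 0 < q.1 ∧ (∀ y : ℝ × ℝ, y.1 ^ 2 * U y ≤ q.1 ^ 2 * U q) ∧ 0 < q.1 ^ 2 * U q := by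
  set Γ : ℝ × ℝ → ℝ := fun p => p.1 ^ 2 * U p with hΓ
  have hΓc : Continuous Γ := (continuous_fst.pow 2).mul hU
  have hev' : ∀ p : ℝ × ℝ, Γ (-p.1, p.2) = Γ p := fun p => by
    simp only [hΓ, neg_sq, heven p.1 p.2]
  have hev : ∀ᶠ p in cocompact (ℝ × ℝ), Γ p ≤ Γ q₀ :=
    (hdecay.eventually (Iio_mem_nhds hpos)).mono fun p hp => hp.le
  obtain ⟨m, hm⟩ := hΓc.exists_forall_ge' q₀ hev
  have hmpos : 0 < Γ m := hpos.trans_le (hm q₀)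
  have hm1 : m.1 ≠ 0 := by
    intro h0
    have : Γ m = 0 := by simp [hΓ, h0]
    exact hmpos.ne' this
  rcases hm1.lt_or_gt with hlt | hgt
  · refine ⟨(-m.1, m.2), by simpa using hlt, fun y => ?_, ?_⟩
    · show Γ y ≤ Γ (-m.1, m.2)
      rw [hev' m]; exact hm y
    · show 0 < Γ (-m.1, m.2)
      rw [hev' m]; exact hmpos
  · exact ⟨m, hgt, hm, hmpos⟩

/-- A function decaying at infinity in the meridian plane takes values below any `M > 0` at some
point of the open right half-plane. [folklore] -/
private theorem exists_lt_of_tendsto_cocompact {Γ : ℝ × ℝ → ℝ}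
    (hdecay : Tendsto Γ (cocompact (ℝ × ℝ)) (𝓝 0)) {M : ℝ} (hM : 0 < M) :
    ∃ p : ℝ × ℝ, 0 < p.1 ∧ Γ p < M := by
  have hev : ∀ᶠ p in cocompact (ℝ × ℝ), Γ p < M := hdecay.eventually (Iio_mem_nhds hM)
  obtain ⟨K, hK, hKs⟩ := mem_cocompact.1 hev
  obtain ⟨R, hR⟩ := isBounded_iff_forall_norm_le.1 hK.isBounded
  refine ⟨(|R| + 1, 0), by positivity, ?_⟩
  apply hKs
  intro hpK
  have h1 : ‖((|R| + 1, 0) : ℝ × ℝ)‖ ≤ R := hR _ hpK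
  have h2 : ‖((|R| + 1, 0) : ℝ × ℝ).1‖ ≤ ‖((|R| + 1, 0) : ℝ × ℝ)‖ := norm_fst_le _
  dsimp only at h2
  rw [Real.norm_eq_abs, abs_of_pos (by positivity)] at h2
  linarith [le_abs_self R]

namespace HouSelfSimilarProfile

variable {n ν₀ cl cu : ℝ} {U Ω Ψ : ℝ × ℝ → ℝ}

/-! ### The Hopf step: at `n = 3`, `c_Γ = 0` is incompatible with a decaying positive maximum -/

/-- **The strong-maximum-principle step.** For a profile at `n = 3` with `ν₀ > 0` and
`c_u + 2c_l = 0`, a circulation `Γ̃ = ξ²ũ₁` that decays at infinity cannot be positive anywhere: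
otherwise it attains a positive maximum `M` in the open half-plane, where (`circulation_eq`) it
solves `−ΔΓ̃ + (1/ξ + (c_lξ + ũ^ξ)/ν₀)Γ̃_ξ + ((c_lη + ũ^η)/ν₀)Γ̃_η = 0`, and E. Hopf's minimum principle
(`Literature.Analysis.PDE.hopf_minimumPrinciple`, applied to `−Γ̃`) forces `Γ̃ ≡ M` on `{ξ > 0}`,
contradicting the decay. [cite: Hou2026, §3 (rescaled Γ̃-equation, c_Γ = c_u + 2c_lr)] -/
theorem not_pos_circulation_of_circulationExponent_eq_zero_of_eq_three
    (hP : HouSelfSimilarProfile n ν₀ cl cu U Ω Ψ) (hn : n = 3) (hν : 0 < ν₀)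
    (hc : cu + 2 * cl = 0)
    (hdecay : Tendsto (fun p : ℝ × ℝ => p.1 ^ 2 * U p) (cocompact (ℝ × ℝ)) (𝓝 0))
    (q₀ : ℝ × ℝ) : ¬ 0 < q₀.1 ^ 2 * U q₀ := by
  intro hpos
  subst hn
  obtain ⟨q, hq1, hqmax, hqpos⟩ :=
    exists_isMaxOn_circulation hP.smooth_U.continuous hP.even_U hdecay hpos
  set M : ℝ := q.1 ^ 2 * U q with hM
  -- the circulation of the mirrored profile `(−U, Ω, Ψ)`, transported to `EuclideanSpace ℝ (Fin 2)`
  have hPn := hP.neg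
  set Γn : ℝ × ℝ → ℝ := fun p => p.1 ^ 2 * (fun p' : ℝ × ℝ => -U p') p with hΓn
  have hΓn_eq : ∀ p, Γn p = -(p.1 ^ 2 * U p) := fun p => by simp only [hΓn]; ring
  have hΓns : ContDiff ℝ ∞ Γn := (contDiff_fst.pow 2).mul hP.smooth_U.neg
  -- the coordinate map `x ↦ (x₀, x₁)` and the points with prescribed coordinates
  set T : EuclideanSpace ℝ (Fin 2) →L[ℝ] ℝ × ℝ :=
    (EuclideanSpace.proj 0).prod (EuclideanSpace.proj 1) with hTdef
  have hT : ∀ x, T x = (x 0, x 1) := fun x => by simp [hTdef]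
  have hT0 : T (EuclideanSpace.single 0 1) = ((1 : ℝ), (0 : ℝ)) := by simp [hT]
  have hT1 : T (EuclideanSpace.single 1 1) = ((0 : ℝ), (1 : ℝ)) := by simp [hT]
  have hpt : ∀ a c : ℝ, (EuclideanSpace.single 0 a + EuclideanSpace.single 1 c :
      EuclideanSpace ℝ (Fin 2)) 0 = a ∧
      T (EuclideanSpace.single 0 a + EuclideanSpace.single 1 c) = (a, c) := fun a c => by
    constructor <;> simp [hT]
  set u : EuclideanSpace ℝ (Fin 2) → ℝ := fun x => Γn (T x) with hu
  have hus : ContDiff ℝ ∞ u := hΓns.comp T.contDiff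
  set Ωs : Set (EuclideanSpace ℝ (Fin 2)) := {x | 0 < x 0} with hΩs
  -- drift coefficients of `𝔏 = −Δ + b·∇` (the circulation equation at `n = 3`, `c_Γ = 0`, over `ν₀`)
  set b : EuclideanSpace ℝ (Fin 2) → Fin 2 → ℝ := fun x i =>
    if i = 0 then 1 / (T x).1 + (cl * (T x).1 + GeneralizedAxisymNS.radialVel Ψ (T x)) / ν₀
    else (cl * (T x).2 + GeneralizedAxisymNS.axialVel 3 Ψ (T x)) / ν₀ with hb
  have h10 : ((1 : Fin 2) = 0) = False := by simp
  have h01 : ((0 : Fin 2) = 1) = False := by simp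
  have hx₀ : (EuclideanSpace.single 0 q.1 + EuclideanSpace.single 1 q.2 :
      EuclideanSpace ℝ (Fin 2)) ∈ Ωs := by
    show 0 < (EuclideanSpace.single 0 q.1 + EuclideanSpace.single 1 q.2 :
      EuclideanSpace ℝ (Fin 2)) 0
    rw [(hpt q.1 q.2).1]; exact hq1
  have hconst : ∀ x ∈ Ωs, u x = -M := by
    refine Literature.Analysis.PDE.hopf_minimumPrinciple (N := 2) isOpen_halfPlane
      isPreconnected_halfPlane (a := fun _ i j => if i = j then 1 else 0) (b := b) (c := fun _ => 0)
      (μ := 1) (m := -M) (fun _ _ i j => by simp [eq_comm]) one_pos ?_ ?_ (fun _ _ => le_rfl)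
      (hus.contDiffOn.of_le (by norm_cast)) ?_ (by linarith) ?_ hx₀ ?_
    · -- ellipticity of the identity matrix
      intro x _ ξ
      rw [one_mul, EuclideanSpace.real_norm_sq_eq]
      refine le_of_eq (Finset.sum_congr rfl fun i _ => ?_)
      simp only [ite_mul, one_mul, zero_mul, Finset.sum_ite_eq, Finset.mem_univ, if_true]
      ring
    · -- local boundedness of the coefficients: `b` is continuous on the open half-plane
      intro K hK hKc
      have hTc : Continuous (fun x : EuclideanSpace ℝ (Fin 2) => T x) := T.continuous
      have hc0 : ContinuousOn (fun x => b x 0) Ωs := by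
        have h1 : ContinuousOn (fun x : EuclideanSpace ℝ (Fin 2) => 1 / (T x).1) Ωs := by
          refine ContinuousOn.div continuousOn_const (continuous_fst.comp hTc).continuousOn ?_
          intro x hx
          have : (T x).1 = x 0 := by rw [hT]
          rw [this]; exact (ne_of_gt hx)
        have h2 : Continuous (fun x : EuclideanSpace ℝ (Fin 2) =>
            (cl * (T x).1 + GeneralizedAxisymNS.radialVel Ψ (T x)) / ν₀) := by
          refine Continuous.div_const ?_ _
          refine (continuous_const.mul (continuous_fst.comp hTc)).add ?_
          simp only [GeneralizedAxisymNS.radialVel]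
          exact ((continuous_fst.comp hTc).mul
            ((contDiff_derivZ hP.smooth_Ψ).continuous.comp hTc)).neg
        have e : (fun x => b x 0) = fun x : EuclideanSpace ℝ (Fin 2) =>
            1 / (T x).1 + (cl * (T x).1 + GeneralizedAxisymNS.radialVel Ψ (T x)) / ν₀ := by
          funext x; simp only [hb, if_true]
        rw [e]; exact h1.add h2.continuousOn
      have hc1 : ContinuousOn (fun x => b x 1) Ωs := by
        have h2 : Continuous (fun x : EuclideanSpace ℝ (Fin 2) =>
            (cl * (T x).2 + GeneralizedAxisymNS.axialVel 3 Ψ (T x)) / ν₀) := by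
          refine Continuous.div_const ?_ _
          refine (continuous_const.mul (continuous_snd.comp hTc)).add ?_
          simp only [GeneralizedAxisymNS.axialVel]
          exact (continuous_const.mul (hP.smooth_Ψ.continuous.comp hTc)).add
            ((continuous_fst.comp hTc).mul ((contDiff_derivR hP.smooth_Ψ).continuous.comp hTc))
        have e : (fun x => b x 1) = fun x : EuclideanSpace ℝ (Fin 2) =>
            (cl * (T x).2 + GeneralizedAxisymNS.axialVel 3 Ψ (T x)) / ν₀ := by
          funext x; simp only [hb, h10, if_false]
        rw [e]; exact h2.continuousOn
      obtain ⟨C0, hC0⟩ := hKc.exists_bound_of_continuousOn (hc0.mono hK)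
      obtain ⟨C1, hC1⟩ := hKc.exists_bound_of_continuousOn (hc1.mono hK)
      refine ⟨max 1 (max C0 C1), fun x hx => ⟨fun i j => ?_, fun i => ?_, by simp⟩⟩
      · split_ifs <;> simp
      · fin_cases i
        · exact ((Real.norm_eq_abs _).symm.le.trans (hC0 x hx)).trans
            ((le_max_left _ _).trans (le_max_right _ _))
        · exact ((Real.norm_eq_abs _).symm.le.trans (hC1 x hx)).trans
            ((le_max_right _ _).trans (le_max_right _ _))
    · -- `𝔏u = 0`: the circulation equation of `(−U, Ω, Ψ)` at `T x`, `n = 3`, `c_Γ = 0`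
      intro x hx
      have hq' : 0 < (T x).1 := by rw [hT]; exact hx
      have hce := hPn.circulation_eq hq'
      have d0 : fderiv ℝ u x (EuclideanSpace.single 0 1) = derivR Γn (T x) := by
        rw [hu, fderiv_comp_clm (hΓns.differentiable (by simp)), hT0, derivR_apply]
      have d1 : fderiv ℝ u x (EuclideanSpace.single 1 1) = derivZ Γn (T x) := by
        rw [hu, fderiv_comp_clm (hΓns.differentiable (by simp)), hT1, derivZ_apply]
      have d00 : fderiv ℝ (fderiv ℝ u) x (EuclideanSpace.single 0 1) (EuclideanSpace.single 0 1) =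
          derivR (derivR Γn) (T x) := by
        rw [hu]; exact fderiv_fderiv_comp_clm_zero_zero hΓns hT0 x
      have d11 : fderiv ℝ (fderiv ℝ u) x (EuclideanSpace.single 1 1) (EuclideanSpace.single 1 1) =
          derivZ (derivZ Γn) (T x) := by
        rw [hu]; exact fderiv_fderiv_comp_clm_one_one hΓns hT1 x
      simp only [Fin.sum_univ_two, h10, h01, if_true, if_false, one_mul, zero_mul,
        add_zero, zero_add, hb, d0, d1, d00, d11]
      have e34 : ((3 : ℝ) - 4) = -1 := by norm_num
      have e66 : ((6 : ℝ) - 2 * 3) = 0 := by norm_num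
      rw [hc, zero_mul, zero_add, e34, e66, zero_div, zero_mul, add_zero] at hce
      set ξ := (T x).1
      set η := (T x).2
      set GR := derivR Γn (T x)
      set GZ := derivZ Γn (T x)
      set GRR := derivR (derivR Γn) (T x)
      set GZZ := derivZ (derivZ Γn) (T x)
      set rV := GeneralizedAxisymNS.radialVel Ψ (T x)
      set aV := GeneralizedAxisymNS.axialVel 3 Ψ (T x)
      have hξ : ξ ≠ 0 := hq'.ne'
      have hν' : ν₀ ≠ 0 := hν.ne'
      have key : ν₀ * (GRR + GZZ) =
          ν₀ * ((1 / ξ + (cl * ξ + rV) / ν₀) * GR + ((cl * η + aV) / ν₀) * GZ) := by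
        have e1 : ν₀ * ((1 / ξ + (cl * ξ + rV) / ν₀) * GR + ((cl * η + aV) / ν₀) * GZ) =
            ν₀ / ξ * GR + (cl * ξ + rV) * GR + (cl * η + aV) * GZ := by
          field_simp
        rw [e1]
        have e2 : ν₀ * (GRR + -1 / ξ * GR + GZZ) = ν₀ * (GRR + GZZ) - ν₀ / ξ * GR := by ring
        linarith [hce, e2]
      have key' : GRR + GZZ = (1 / ξ + (cl * ξ + rV) / ν₀) * GR + ((cl * η + aV) / ν₀) * GZ :=
        mul_left_cancel₀ hν' key
      linarith [key']
    · -- `u ≥ −M`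
      intro x _
      simp only [hu, hΓn_eq]
      linarith [hqmax (T x)]
    · -- `u (q) = −M`
      simp only [hu, hΓn_eq, (hpt q.1 q.2).2, hM]
  -- the constant `Γ̃ ≡ M > 0` on the half-plane does not decay
  obtain ⟨p, hp1, hpM⟩ := exists_lt_of_tendsto_cocompact hdecay hqpos
  have h1 := hconst (EuclideanSpace.single 0 p.1 + EuclideanSpace.single 1 p.2)
    (by
      show 0 < (EuclideanSpace.single 0 p.1 + EuclideanSpace.single 1 p.2 :
        EuclideanSpace ℝ (Fin 2)) 0
      rw [(hpt p.1 p.2).1]; exact hp1)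
  simp only [hu, hΓn_eq, (hpt p.1 p.2).2] at h1
  have : p.1 ^ 2 * U p = M := by linarith
  exact hpM.ne this

/-! ### Strict global form at `n = 3` and for all `n ≥ 3` -/

/-- **`n = 3`, `ν₀ > 0`: the circulation exponent is STRICTLY positive, `0 < c_u + 2c_l`,** for every
profile whose circulation `Γ̃ = ξ²ũ₁` tends to `0` at infinity and whose swirl is not identically zero
off the axis (weak maximum principle of the companion file for `≥`; E. Hopf's strong maximum
principle excludes `=`). [cite: Hou2026, §3 (rescaled Γ̃-equation, c_Γ = c_u + 2c_lr)] -/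
theorem circulationExponent_pos_of_tendsto_zero_of_eq_three
    (hP : HouSelfSimilarProfile n ν₀ cl cu U Ω Ψ) (hn : n = 3) (hν : 0 < ν₀)
    (hdecay : Tendsto (fun p : ℝ × ℝ => p.1 ^ 2 * U p) (cocompact (ℝ × ℝ)) (𝓝 0))
    (hne : ∃ q : ℝ × ℝ, q.1 ≠ 0 ∧ U q ≠ 0) : 0 < cu + 2 * cl := by
  have h0 : 0 ≤ cu + 2 * cl :=
    hP.circulationExponent_nonneg_of_tendsto_zero (by rw [hn]) hν.le hdecay hne
  refine lt_of_le_of_ne h0 fun hc => ?_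
  obtain ⟨q₀, hq₀, hU₀⟩ := hne
  have hsq : 0 < q₀.1 ^ 2 := by positivity
  rcases hU₀.lt_or_gt with hneg | hpos
  · -- `U < 0` somewhere: the mirrored profile `(−U, Ω, Ψ)` has a positive circulation value
    have hdecay' : Tendsto (fun p : ℝ × ℝ => p.1 ^ 2 * (fun p' : ℝ × ℝ => -U p') p)
        (cocompact (ℝ × ℝ)) (𝓝 0) := by
      simpa [mul_neg] using hdecay.neg
    have hpos' : 0 < q₀.1 ^ 2 * (fun p' : ℝ × ℝ => -U p') q₀ := by
      simp only [mul_neg]; nlinarith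
    exact not_pos_circulation_of_circulationExponent_eq_zero_of_eq_three hP.neg hn hν hc.symm
      hdecay' q₀ hpos'
  · exact not_pos_circulation_of_circulationExponent_eq_zero_of_eq_three hP hn hν hc.symm hdecay
      q₀ (mul_pos hsq hpos)

/-- **Unified strict form, `n ≥ 3`, `ν₀ > 0`: `0 < c_u + 2c_l`** for decaying, nontrivial circulation
(`n = 3`: `circulationExponent_pos_of_tendsto_zero_of_eq_three`; `n > 3`: the companion file's
`circulationExponent_pos_of_tendsto_zero`). [cite: Hou2026, §3 (rescaled Γ̃-equation, c_Γ = c_u + 2c_lr)] -/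
theorem circulationExponent_pos_of_tendsto_zero_of_three_le
    (hP : HouSelfSimilarProfile n ν₀ cl cu U Ω Ψ) (hn : 3 ≤ n) (hν : 0 < ν₀)
    (hdecay : Tendsto (fun p : ℝ × ℝ => p.1 ^ 2 * U p) (cocompact (ℝ × ℝ)) (𝓝 0))
    (hne : ∃ q : ℝ × ℝ, q.1 ≠ 0 ∧ U q ≠ 0) : 0 < cu + 2 * cl := by
  rcases hn.eq_or_lt with h3 | h3
  · exact hP.circulationExponent_pos_of_tendsto_zero_of_eq_three h3.symm hν hdecay hne
  · exact hP.circulationExponent_pos_of_tendsto_zero h3 hν hdecay hne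

/-- **Contrapositive at the parabolic corner, now including `n = 3`:** a nontrivial profile with
`c_u + 2c_l ≤ 0` — in particular one at the Navier–Stokes gauge `ĉ_l = ½`, `c_u + 2c_l = 0` — cannot
have circulation decaying at infinity (`n ≥ 3`, `ν₀ > 0`).
[cite: Hou2026, §3 (rescaled Γ̃-equation, c_Γ = c_u + 2c_lr)] -/
theorem not_tendsto_circulation_zero_of_circulationExponent_nonpos_of_three_le
    (hP : HouSelfSimilarProfile n ν₀ cl cu U Ω Ψ) (hn : 3 ≤ n) (hν : 0 < ν₀)
    (hc : cu + 2 * cl ≤ 0) (hne : ∃ q : ℝ × ℝ, q.1 ≠ 0 ∧ U q ≠ 0) :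
    ¬ Tendsto (fun p : ℝ × ℝ => p.1 ^ 2 * U p) (cocompact (ℝ × ℝ)) (𝓝 0) := fun hdecay =>
  (hP.circulationExponent_pos_of_tendsto_zero_of_three_le hn hν hdecay hne).not_ge hc

end HouSelfSimilarProfile

/-! ### Dictionary: strict form `½ < ĉ_l` on the blow-up side -/

/-- On the blow-up side `κ = −c_u > 0`, `0 < c_u + 2c_l` reads `½ < ĉ_l = c_l/κ`: the normalized
length exponent of a decaying-circulation profile (`n ≥ 3`, `ν₀ > 0`) is STRICTLY above the parabolic
value `½` at which the solution-dependent viscosity `ν₀(T−t)^{2ĉ_l−1}` is constant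
(arXiv:2405.10916 §1.1). [cite: Hou2026, §1.1 (ν = ν₀(T−t)^{2c_l−1})] -/
theorem half_lt_collapseExponent {cl cu : ℝ} (h : 0 < cu + 2 * cl) (hκ : 0 < -cu) :
    1 / 2 < cl / (-cu) := by
  rw [lt_div_iff₀ hκ]
  linarith

/-- The same in the vocabulary of `HouScalingExponents` (one-scale regime `c_lr = c_lz = c_l`,
`κ = −c_u`): `0 < c_u + 2c_lz` and `κ > 0` give `½ < ĉ_lz`, i.e. the viscosity-law exponent
`2ĉ_lz − 1` of `physicalViscosity_eq_rpow` is STRICTLY positive (vanishing MODEL viscosity at the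
collapse). [cite: Hou2026, §1.1 (ν = ν₀(T−t)^{2c_l−1})] -/
theorem HouScalingExponents.half_lt_hat_clz (e : HouScalingExponents) (h : 0 < e.cu + 2 * e.clz)
    (hκ : 0 < e.kappa) : 1 / 2 < e.hat e.clz := by
  rw [HouScalingExponents.hat, lt_div_iff₀ hκ]
  have := e.kappa_eq_neg_cu
  linarith

/-! ### Consequence for the MODEL viscosity law: the decaying-circulation branch is never at constant viscosity -/

/-- **The MODEL viscosity of a decaying-circulation collapse VANISHES at the blow-up time.** Let
`e : HouScalingExponents` be the exponents of a one-scale collapse (`κ > 0`, `c_l = c_lz`) whose steady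
profile at `n = 3`, `ν₀ > 0` has circulation decaying at infinity and nontrivial swirl. Then
`½ < ĉ_lz` strictly (`circulationExponent_pos_of_tendsto_zero_of_eq_three`), so the solution-dependent
physical viscosity `ν(τ) = ν₀(κ(T−t))^{2ĉ_lz−1}` of arXiv:2405.10916 §1.1/§3 tends to `0` as `τ → ∞`
(`HouScalingExponents.tendsto_physicalViscosity_zero`): such a profile is NOT a constant-viscosity
(Navier–Stokes) self-similar blow-up — the kernel form of the zone's standing label «V-MODEL (ν(t) law)»
for the whole branch, not only for Hou's printed member `ĉ_l = 0.5233` (`tendsto_hou2026_viscosity_zero`).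
[cite: Hou2026, §1.1 (ν = ν₀(T−t)^{2c_l−1})] -/
theorem HouScalingExponents.tendsto_physicalViscosity_zero_of_profile (e : HouScalingExponents)
    {n ν₀ : ℝ} {U Ω Ψ : ℝ × ℝ → ℝ} (hP : HouSelfSimilarProfile n ν₀ e.clz e.cu U Ω Ψ) (hn : n = 3)
    (hν : 0 < ν₀) (hκ : 0 < e.kappa)
    (hdecay : Tendsto (fun p : ℝ × ℝ => p.1 ^ 2 * U p) (cocompact (ℝ × ℝ)) (𝓝 0))
    (hne : ∃ q : ℝ × ℝ, q.1 ≠ 0 ∧ U q ≠ 0) (ν₁ : ℝ) :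
    Tendsto (e.physicalViscosity ν₁) atTop (𝓝 0) :=
  e.tendsto_physicalViscosity_zero hκ
    (e.half_lt_hat_clz (hP.circulationExponent_pos_of_tendsto_zero_of_eq_three hn hν hdecay hne) hκ) ν₁

/-- The same read on the exponent: such a collapse has viscosity-law exponent `2ĉ_lz − 1 > 0`
(`ν ∝ (T−t)^{2ĉ_l−1} → 0`), never the constant-viscosity value `0`.
[cite: Hou2026, §1.1 (ν = ν₀(T−t)^{2c_l−1})] -/
theorem HouScalingExponents.viscosityLawExponent_pos_of_profile (e : HouScalingExponents)
    {n ν₀ : ℝ} {U Ω Ψ : ℝ × ℝ → ℝ} (hP : HouSelfSimilarProfile n ν₀ e.clz e.cu U Ω Ψ) (hn : n = 3)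
    (hν : 0 < ν₀) (hκ : 0 < e.kappa)
    (hdecay : Tendsto (fun p : ℝ × ℝ => p.1 ^ 2 * U p) (cocompact (ℝ × ℝ)) (𝓝 0))
    (hne : ∃ q : ℝ × ℝ, q.1 ≠ 0 ∧ U q ≠ 0) :
    0 < 2 * e.hat e.clz - 1 := by
  have h := e.half_lt_hat_clz (hP.circulationExponent_pos_of_tendsto_zero_of_eq_three hn hν hdecay hne) hκ
  linarith

end Literature.Analysis.FluidPDE
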